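import Literature.Analysis.FluidPDE.PlanarBandPieces
import HarnessLib

/-!
# Order conditions and cover of a typed chain from rational checks

Topic `Literature/Analysis/FluidPDE`. Level-4 data model, part 5 (after `PlanarBandPieces.lean`).
The diagonal well-formedness of a phase (`PhaseQ.wfbd`, `PlanarTypedChain.lean`) was left with the
three ORDER conditions as the hypothesis `PhaseQ.Orders`, and the transport of the assembled move
(`MovingChain.WFBd.transport_move`, `PlanarFrozenChain.lean`) needs the per-element COVER: every
point of `tubeBox k ∩ Band k` lies in the core of `k` or in a junction region with one of its
neighbours, inside the agreement region. This file discharges both from Boolean tests on the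
rational data:

* **step functionals.** `StepQ.argLeFun J c`, `StepQ.argGeFun J c` are affine lab functionals
  (`LinFun`) whose (strict) negativity is `arg ≤ c` / `c ≤ arg` (`<`), and `BoxQ.innerFun q` those
  whose strict negativity is membership in the open inner box; positivity / sub-unity of the smooth
  step from its argument (`step_pos_of_gt`, `step_lt_one_of_lt`).
* **order_fwd / order_bwd** from sup / inf bounds of the step arguments over the box overlaps
  (`StepQ.supLeB`, `infGtB`, `infGeB`, `supLtB`: one candidate bound among the support / inner
  edges suffices; endpoint checks).
* **order_band and the cover** from the tagged band pieces of `PlanarBandPieces.lean`: on every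
  piece of element `k` the checker verifies (strictly, at the four corners) the list of functionals
  of the cover case named by the piece's tag — core (`0`), junction with the predecessor (`1`),
  junction with the successor (`2`), including membership in the **agreement regions**
  `PhaseQ.Agree k` (open `u`-slabs of the two elements read off the junction kind `JKindQ.forms`;
  all of space-time for `identical`).
* `PhaseQ.orders_of_geomB : P.geomB = true → P.Orders` and `PhaseQ.cover_of_geomB` (the cover
  hypothesis of `WFBd.transport_move` for ALL times and points), `PhaseQ.isOpen_Agree`.

Folklore; no named facts. Infrastructure towards a discharge of `acm_compatible_blocks`
(`QuasiSelfSimilarCompatibleBlocks.lean`).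

## References

* G. Alberti, G. Crippa, A. L. Mazzucato, *Exponential self-similar mixing by incompressible
  flows*, J. Amer. Math. Soc. 32 (2019), 445–490, §§7–8 (arXiv:1605.02090).
-/

noncomputable section

open Function Set Filter
open scoped Topology ContDiff

namespace Literature.Analysis.FluidPDE

namespace PlanarKinematics

open Gluing

/-- The plane `ℝ²` as a Euclidean space. [folklore] -/
local notation "E²" => EuclideanSpace ℝ (Fin 2)

/-! ## The smooth step from its argument -/

/-- The step is positive past `1/3`. [folklore] -/
theorem step_pos_of_gt {x : ℝ} (hx : 1 / 3 < x) : 0 < step x :=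
  Real.smoothTransition.pos_of_pos (by linarith)

/-- The step is below `1` before `2/3`. [folklore] -/
theorem step_lt_one_of_lt {x : ℝ} (hx : x < 2 / 3) : step x < 1 :=
  Real.smoothTransition.lt_one_of_lt_one (by linarith)

namespace JStep

/-- If the step vanishes, the argument is at most `1/3`. [folklore] -/
theorem arg_le_of_val_eq_zero (J : JStep) {t : ℝ} {z : E²} (h : J.val t z = 0) : J.arg t z ≤ 1 / 3 := by
  by_contra h'
  push Not at h'
  have := step_pos_of_gt h'
  rw [← JStep.val] at this
  exact this.ne' h

/-- If the step is `1`, the argument is at least `2/3`. [folklore] -/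
theorem arg_ge_of_val_eq_one (J : JStep) {t : ℝ} {z : E²} (h : J.val t z = 1) : 2 / 3 ≤ J.arg t z := by
  by_contra h'
  push Not at h'
  have := step_lt_one_of_lt h'
  rw [← JStep.val] at this
  exact this.ne h

end JStep

/-! ## Step functionals -/

namespace StepQ

variable (J : StepQ)

/-- The unit vector of the step axis as rational coefficients. [folklore] -/
def axC (J : StepQ) : ℚ × ℚ := if J.axis = 0 then (1, 0) else (0, 1)

/-- The axis coordinate as a linear form. [folklore] -/
theorem axC_apply (z : E²) : (J.axC.1 : ℝ) * z 0 + (J.axC.2 : ℝ) * z 1 = z J.axis := by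
  unfold axC
  by_cases h : J.axis = 0
  · rw [if_pos h, h]; simp
  · have h1 : J.axis = 1 := by omega
    rw [if_neg h, h1]; simp

/-- **`arg ≤ c` functional**: `s (z_i - pos) - c · len`. [folklore] -/
def argLeFun (J : StepQ) (c : ℚ) : LinFun :=
  ⟨J.sgn * J.axC.1, J.sgn * J.axC.2, (Aff.smul (-J.sgn) J.pos).sub (Aff.const (c * J.len))⟩

/-- **`c ≤ arg` functional**: `c · len - s (z_i - pos)`. [folklore] -/
def argGeFun (J : StepQ) (c : ℚ) : LinFun :=
  ⟨-J.sgn * J.axC.1, -J.sgn * J.axC.2, (Aff.smul J.sgn J.pos).add (Aff.const (c * J.len))⟩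

/-- Value of the `arg ≤ c` functional. [folklore] -/
theorem argLeFun_eval (c : ℚ) (α : ℝ) (z : E²) :
    (J.argLeFun c).eval α z = (J.sgn : ℝ) * (z J.axis - J.pos.eval α) - c * J.len := by
  rw [argLeFun, LinFun.eval, Aff.eval_sub, Aff.eval_smul, Aff.eval_const, ← J.axC_apply z]; push_cast; ring

/-- Value of the `c ≤ arg` functional. [folklore] -/
theorem argGeFun_eval (c : ℚ) (α : ℝ) (z : E²) :
    (J.argGeFun c).eval α z = (c : ℝ) * J.len - J.sgn * (z J.axis - J.pos.eval α) := by
  rw [argGeFun, LinFun.eval, Aff.eval_add, Aff.eval_smul, Aff.eval_const, ← J.axC_apply z]; push_cast; ring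

/-- The argument of the clocked step. [folklore] -/
theorem arg_eq (t₀ τ t : ℝ) (z : E²) :
    (J.toJ t₀ τ).arg t z = J.sgn * (z J.axis - J.pos.eval (clock t₀ τ t)) / J.len := rfl

/-- **`arg ≤ c` from the functional.** [folklore] -/
theorem arg_le_of_eval_nonpos (hlen : 0 < (J.len : ℝ)) {c : ℚ} {t₀ τ t : ℝ} {z : E²}
    (h : (J.argLeFun c).eval (clock t₀ τ t) z ≤ 0) : (J.toJ t₀ τ).arg t z ≤ c := by
  rw [argLeFun_eval] at h; rw [arg_eq, div_le_iff₀ hlen]; linarith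

/-- **`arg < c` from the functional.** [folklore] -/
theorem arg_lt_of_eval_neg (hlen : 0 < (J.len : ℝ)) {c : ℚ} {t₀ τ t : ℝ} {z : E²}
    (h : (J.argLeFun c).eval (clock t₀ τ t) z < 0) : (J.toJ t₀ τ).arg t z < c := by
  rw [argLeFun_eval] at h; rw [arg_eq, div_lt_iff₀ hlen]; linarith

/-- **`c ≤ arg` from the functional.** [folklore] -/
theorem le_arg_of_eval_nonpos (hlen : 0 < (J.len : ℝ)) {c : ℚ} {t₀ τ t : ℝ} {z : E²}
    (h : (J.argGeFun c).eval (clock t₀ τ t) z ≤ 0) : (c : ℝ) ≤ (J.toJ t₀ τ).arg t z := by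
  rw [argGeFun_eval] at h; rw [arg_eq, le_div_iff₀ hlen]; linarith

/-- **`c < arg` from the functional.** [folklore] -/
theorem lt_arg_of_eval_neg (hlen : 0 < (J.len : ℝ)) {c : ℚ} {t₀ τ t : ℝ} {z : E²}
    (h : (J.argGeFun c).eval (clock t₀ τ t) z < 0) : (c : ℝ) < (J.toJ t₀ τ).arg t z := by
  rw [argGeFun_eval] at h; rw [arg_eq, lt_div_iff₀ hlen]; linarith

/-! ### Sup / inf bounds of the argument over box overlaps -/

/-- **Sup test**: one of the candidate upper bounds (`s = 1`) / lower bounds (`s = -1`) of the axis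
coordinate pins `arg ≤ c`. [folklore] -/
def supLeB (J : StepQ) (his los : Fin 2 → List Aff) (c : ℚ) : Bool :=
  (decide (J.sgn = 1) && (his J.axis).any fun H => Aff.leB H (J.pos.add (Aff.const (c * J.len)))) ||
    (decide (J.sgn = -1) && (los J.axis).any fun L => Aff.leB (J.pos.sub (Aff.const (c * J.len))) L)

/-- **Strict sup test** (`arg < c`). [folklore] -/
def supLtB (J : StepQ) (his los : Fin 2 → List Aff) (c : ℚ) : Bool :=
  (decide (J.sgn = 1) && (his J.axis).any fun H => Aff.ltB H (J.pos.add (Aff.const (c * J.len)))) ||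
    (decide (J.sgn = -1) && (los J.axis).any fun L => Aff.ltB (J.pos.sub (Aff.const (c * J.len))) L)

/-- **Inf test** (`c ≤ arg`). [folklore] -/
def infGeB (J : StepQ) (his los : Fin 2 → List Aff) (c : ℚ) : Bool :=
  (decide (J.sgn = 1) && (los J.axis).any fun L => Aff.leB (J.pos.add (Aff.const (c * J.len))) L) ||
    (decide (J.sgn = -1) && (his J.axis).any fun H => Aff.leB H (J.pos.sub (Aff.const (c * J.len))))

/-- **Strict inf test** (`c < arg`). [folklore] -/
def infGtB (J : StepQ) (his los : Fin 2 → List Aff) (c : ℚ) : Bool :=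
  (decide (J.sgn = 1) && (los J.axis).any fun L => Aff.ltB (J.pos.add (Aff.const (c * J.len))) L) ||
    (decide (J.sgn = -1) && (his J.axis).any fun H => Aff.ltB H (J.pos.sub (Aff.const (c * J.len))))

/-- Soundness of the sup test. [folklore] -/
theorem arg_le_of_supLeB (hlen : 0 < (J.len : ℝ)) {his los : Fin 2 → List Aff} {c : ℚ} (h : J.supLeB his los c = true)
    {t₀ τ t : ℝ} {z : E²} (hhi : ∀ i, ∀ H ∈ his i, z i ≤ H.eval (clock t₀ τ t))
    (hlo : ∀ i, ∀ L ∈ los i, L.eval (clock t₀ τ t) ≤ z i) : (J.toJ t₀ τ).arg t z ≤ c := by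
  have hα := clock_mem_Icc t₀ τ t
  rw [arg_eq, div_le_iff₀ hlen]
  simp only [supLeB, Bool.or_eq_true, Bool.and_eq_true, decide_eq_true_eq, List.any_eq_true] at h
  rcases h with ⟨hs, H, hH, hle⟩ | ⟨hs, L, hL, hle⟩
  · have e := Aff.eval_le_eval hle hα
    rw [Aff.eval_add, Aff.eval_const] at e
    have hz := hhi _ H hH
    rw [hs]; push_cast at e ⊢; linarith
  · have e := Aff.eval_le_eval hle hα
    rw [Aff.eval_sub, Aff.eval_const] at e
    have hz := hlo _ L hL
    rw [hs]; push_cast at e ⊢; linarith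

/-- Soundness of the strict sup test. [folklore] -/
theorem arg_lt_of_supLtB (hlen : 0 < (J.len : ℝ)) {his los : Fin 2 → List Aff} {c : ℚ} (h : J.supLtB his los c = true)
    {t₀ τ t : ℝ} {z : E²} (hhi : ∀ i, ∀ H ∈ his i, z i ≤ H.eval (clock t₀ τ t))
    (hlo : ∀ i, ∀ L ∈ los i, L.eval (clock t₀ τ t) ≤ z i) : (J.toJ t₀ τ).arg t z < c := by
  have hα := clock_mem_Icc t₀ τ t
  rw [arg_eq, div_lt_iff₀ hlen]
  simp only [supLtB, Bool.or_eq_true, Bool.and_eq_true, decide_eq_true_eq, List.any_eq_true] at h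
  rcases h with ⟨hs, H, hH, hle⟩ | ⟨hs, L, hL, hle⟩
  · have e := Aff.eval_lt_eval hle hα
    rw [Aff.eval_add, Aff.eval_const] at e
    have hz := hhi _ H hH
    rw [hs]; push_cast at e ⊢; linarith
  · have e := Aff.eval_lt_eval hle hα
    rw [Aff.eval_sub, Aff.eval_const] at e
    have hz := hlo _ L hL
    rw [hs]; push_cast at e ⊢; linarith

/-- Soundness of the inf test. [folklore] -/
theorem le_arg_of_infGeB (hlen : 0 < (J.len : ℝ)) {his los : Fin 2 → List Aff} {c : ℚ} (h : J.infGeB his los c = true)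
    {t₀ τ t : ℝ} {z : E²} (hhi : ∀ i, ∀ H ∈ his i, z i ≤ H.eval (clock t₀ τ t))
    (hlo : ∀ i, ∀ L ∈ los i, L.eval (clock t₀ τ t) ≤ z i) : (c : ℝ) ≤ (J.toJ t₀ τ).arg t z := by
  have hα := clock_mem_Icc t₀ τ t
  rw [arg_eq, le_div_iff₀ hlen]
  simp only [infGeB, Bool.or_eq_true, Bool.and_eq_true, decide_eq_true_eq, List.any_eq_true] at h
  rcases h with ⟨hs, L, hL, hle⟩ | ⟨hs, H, hH, hle⟩
  · have e := Aff.eval_le_eval hle hα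
    rw [Aff.eval_add, Aff.eval_const] at e
    have hz := hlo _ L hL
    rw [hs]; push_cast at e ⊢; linarith
  · have e := Aff.eval_le_eval hle hα
    rw [Aff.eval_sub, Aff.eval_const] at e
    have hz := hhi _ H hH
    rw [hs]; push_cast at e ⊢; linarith

/-- Soundness of the strict inf test. [folklore] -/
theorem lt_arg_of_infGtB (hlen : 0 < (J.len : ℝ)) {his los : Fin 2 → List Aff} {c : ℚ} (h : J.infGtB his los c = true)
    {t₀ τ t : ℝ} {z : E²} (hhi : ∀ i, ∀ H ∈ his i, z i ≤ H.eval (clock t₀ τ t))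
    (hlo : ∀ i, ∀ L ∈ los i, L.eval (clock t₀ τ t) ≤ z i) : (c : ℝ) < (J.toJ t₀ τ).arg t z := by
  have hα := clock_mem_Icc t₀ τ t
  rw [arg_eq, lt_div_iff₀ hlen]
  simp only [infGtB, Bool.or_eq_true, Bool.and_eq_true, decide_eq_true_eq, List.any_eq_true] at h
  rcases h with ⟨hs, L, hL, hle⟩ | ⟨hs, H, hH, hle⟩
  · have e := Aff.eval_lt_eval hle hα
    rw [Aff.eval_add, Aff.eval_const] at e
    have hz := hlo _ L hL
    rw [hs]; push_cast at e ⊢; linarith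
  · have e := Aff.eval_lt_eval hle hα
    rw [Aff.eval_sub, Aff.eval_const] at e
    have hz := hhi _ H hH
    rw [hs]; push_cast at e ⊢; linarith

end StepQ

/-! ## Box bounds and inner functionals -/

namespace BoxQ

variable (B : BoxQ)

/-- Upper support edge on axis `i`. [folklore] -/
def suppHi (B : BoxQ) (i : Fin 2) : Aff := (if i = 0 then B.b₀ else B.b₁).sub (Aff.const (B.ρ / 3))
/-- Lower support edge on axis `i`. [folklore] -/
def suppLo (B : BoxQ) (i : Fin 2) : Aff := (if i = 0 then B.a₀ else B.a₁).add (Aff.const (B.ρ / 3))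
/-- Upper inner edge on axis `i`. [folklore] -/
def innerHi (B : BoxQ) (i : Fin 2) : Aff := (if i = 0 then B.b₀ else B.b₁).sub (Aff.const (2 * B.ρ / 3))
/-- Lower inner edge on axis `i`. [folklore] -/
def innerLo (B : BoxQ) (i : Fin 2) : Aff := (if i = 0 then B.a₀ else B.a₁).add (Aff.const (2 * B.ρ / 3))

/-- Support bounds. [folklore] -/
theorem suppLo_le {α : ℝ} {z : E²} (hz : z ∈ (B.frzAt α).supp) (i : Fin 2) : (B.suppLo i).eval α ≤ z i := by
  obtain ⟨h1, h2, h3, h4⟩ := hz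
  fin_cases i <;> simp [suppLo, frzAt, Aff.eval_add, Aff.eval_const] at * <;> linarith

/-- Support bounds. [folklore] -/
theorem le_suppHi {α : ℝ} {z : E²} (hz : z ∈ (B.frzAt α).supp) (i : Fin 2) : z i ≤ (B.suppHi i).eval α := by
  obtain ⟨h1, h2, h3, h4⟩ := hz
  fin_cases i <;> simp [suppHi, frzAt, Aff.eval_sub, Aff.eval_const] at * <;> linarith

/-- Inner bounds. [folklore] -/
theorem innerLo_le {α : ℝ} {z : E²} (hz : z ∈ (B.frzAt α).inner) (i : Fin 2) : (B.innerLo i).eval α ≤ z i := by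
  obtain ⟨h1, h2, h3, h4⟩ := hz
  fin_cases i <;> simp [innerLo, frzAt, Aff.eval_add, Aff.eval_const] at * <;> linarith

/-- Inner bounds. [folklore] -/
theorem le_innerHi {α : ℝ} {z : E²} (hz : z ∈ (B.frzAt α).inner) (i : Fin 2) : z i ≤ (B.innerHi i).eval α := by
  obtain ⟨h1, h2, h3, h4⟩ := hz
  fin_cases i <;> simp [innerHi, frzAt, Aff.eval_sub, Aff.eval_const] at * <;> linarith

/-- **Inner functional** `q` (strictly negative inside the open inner box): `0`: `(a₀ + 2ρ/3) - z₀`,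
`1`: `z₀ - (b₀ - 2ρ/3)`, `2`: `(a₁ + 2ρ/3) - z₁`, `3`: `z₁ - (b₁ - 2ρ/3)`. [folklore] -/
def innerFun (B : BoxQ) (q : Fin 4) : LinFun :=
  if q = 0 then ⟨-1, 0, B.a₀.add (Aff.const (2 * B.ρ / 3))⟩
  else if q = 1 then ⟨1, 0, Aff.smul (-1) (B.b₀.sub (Aff.const (2 * B.ρ / 3)))⟩
  else if q = 2 then ⟨0, -1, B.a₁.add (Aff.const (2 * B.ρ / 3))⟩
  else ⟨0, 1, Aff.smul (-1) (B.b₁.sub (Aff.const (2 * B.ρ / 3)))⟩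

/-- **Membership in the inner box from the four inner functionals.** [folklore] -/
theorem mem_inner_of_innerFun_neg {α : ℝ} {z : E²} (h : ∀ q, (B.innerFun q).eval α z < 0) : z ∈ (B.frzAt α).inner := by
  have h0 := h 0; have h1 := h 1; have h2 := h 2; have h3 := h 3
  simp only [innerFun, LinFun.eval, Aff.eval_add, Aff.eval_sub, Aff.eval_smul, Aff.eval_const, Fin.isValue,
    ↓reduceIte, Fin.reduceEq] at h0 h1 h2 h3
  push_cast at h0 h1 h2 h3
  refine ⟨?_, ?_, ?_, ?_⟩ <;> simp only [frzAt] <;> linarith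

end BoxQ

/-! ## The checks of a phase -/

namespace PhaseQ

variable (P : PhaseQ)

/-! ### Order conditions on box overlaps -/

/-- Candidate upper bounds of the coordinates on `supp B ∩ inner B'`. [folklore] -/
def hisOf (B B' : BoxQ) : Fin 2 → List Aff := fun i => [B.suppHi i, B'.innerHi i]

/-- Candidate lower bounds of the coordinates on `supp B ∩ inner B'`. [folklore] -/
def losOf (B B' : BoxQ) : Fin 2 → List Aff := fun i => [B.suppLo i, B'.innerLo i]

/-- The candidates bound the coordinates of a point of the overlap (upper). [folklore] -/
theorem hisOf_bound {B B' : BoxQ} {α : ℝ} {z : E²} (hz : z ∈ (B.frzAt α).supp) (hz' : z ∈ (B'.frzAt α).inner) :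
    ∀ i, ∀ H ∈ hisOf B B' i, z i ≤ H.eval α := by
  intro i H hH
  simp only [hisOf, List.mem_cons, List.mem_nil_iff, or_false] at hH
  rcases hH with rfl | rfl
  · exact B.le_suppHi hz i
  · exact B'.le_innerHi hz' i

/-- The candidates bound the coordinates of a point of the overlap (lower). [folklore] -/
theorem losOf_bound {B B' : BoxQ} {α : ℝ} {z : E²} (hz : z ∈ (B.frzAt α).supp) (hz' : z ∈ (B'.frzAt α).inner) :
    ∀ i, ∀ L ∈ losOf B B' i, L.eval α ≤ z i := by
  intro i L hL
  simp only [losOf, List.mem_cons, List.mem_nil_iff, or_false] at hL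
  rcases hL with rfl | rfl
  · exact B.suppLo_le hz i
  · exact B'.innerLo_le hz' i

/-- **Forward order test** of element `k`: the successor is the last element, or its out-step is `0`
on the overlap `supp B_{k+1} ∩ inner B_k`, or the out-step of `k` is positive there. [folklore] -/
def fwdB (P : PhaseQ) (k : ℕ) : Bool :=
  decide (P.K ≤ k + 2) ||
    (P.node (k + 1)).step.supLeB (hisOf (P.node (k + 1)).box (P.node k).box) (losOf (P.node (k + 1)).box (P.node k).box) (1 / 3) ||
    (P.node k).step.infGtB (hisOf (P.node (k + 1)).box (P.node k).box) (losOf (P.node (k + 1)).box (P.node k).box) (1 / 3)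

/-- **Backward order test** of element `k`: `k = 0`, or the in-step of `k` is `1` on the overlap
`supp B_k ∩ inner B_{k+1}`, or the out-step of `k` is below `1` there. [folklore] -/
def bwdB (P : PhaseQ) (k : ℕ) : Bool :=
  decide (k = 0) ||
    (P.node (k - 1)).step.infGeB (hisOf (P.node k).box (P.node (k + 1)).box) (losOf (P.node k).box (P.node (k + 1)).box) (2 / 3) ||
    (P.node k).step.supLtB (hisOf (P.node k).box (P.node (k + 1)).box) (losOf (P.node k).box (P.node (k + 1)).box) (2 / 3)

/-! ### Agreement regions -/

/-- The two `u`-slab functionals of element `e` for the open interval `(za, zb)`: `za - u(z)` and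
`u(z) - zb` (strictly negative inside). [folklore] -/
def slabFuns (e : ElemQ) (za zb : Aff) : List LinFun :=
  [⟨-e.uC.1, -e.uC.2, za⟩, ⟨e.uC.1, e.uC.2, Aff.smul (-1) zb⟩]

/-- **The agreement functionals of junction `j`**: none for `identical`, the four slab functionals
for `forms`. [folklore] -/
def agreeFuns (P : PhaseQ) (j : ℕ) : List LinFun :=
  match (P.node j).ann.jkind with
  | .identical => []
  | .forms _ _ _ _ za zb za' zb' => slabFuns (P.node j).e za zb ++ slabFuns (P.node (j + 1)).e za' zb'

/-- **The agreement region of junction `j`** (space-time): all functionals of `agreeFuns j` strictly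
negative at `(clock t, z)`. [folklore] -/
def Agree (P : PhaseQ) (j : ℕ) : Set (ℝ × E²) := {p | ∀ φ ∈ P.agreeFuns j, φ.eval (clock P.T0 P.Tau p.1) p.2 < 0}

/-- A lab functional is continuous in space-time (through the clock). [folklore] -/
theorem continuous_linFun_eval (φ : LinFun) (t₀ τ : ℝ) : Continuous fun p : ℝ × E² => φ.eval (clock t₀ τ p.1) p.2 := by
  unfold LinFun.eval
  have h0 : Continuous fun p : ℝ × E² => p.2 0 := (EuclideanSpace.proj (0 : Fin 2)).continuous.comp continuous_snd
  have h1 : Continuous fun p : ℝ × E² => p.2 1 := (EuclideanSpace.proj (1 : Fin 2)).continuous.comp continuous_snd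
  exact ((continuous_const.mul h0).add (continuous_const.mul h1)).add
    ((φ.g.continuous_eval).comp ((clock_contDiff t₀ τ (n := 0)).continuous.comp continuous_fst))

/-- **Agreement regions are open.** [folklore] -/
theorem isOpen_Agree (j : ℕ) : IsOpen (P.Agree j) := by
  have e : P.Agree j = ⋂ φ ∈ {φ : LinFun | φ ∈ P.agreeFuns j}, {p : ℝ × E² | φ.eval (clock P.T0 P.Tau p.1) p.2 < 0} := by
    ext p; simp [Agree, mem_iInter]
  rw [e]
  exact (P.agreeFuns j).finite_toSet.isOpen_biInter fun φ _ => isOpen_lt (continuous_linFun_eval φ _ _) continuous_const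

/-! ### The cover case functionals of a tagged piece -/

/-- The four inner functionals of a box as a list. [folklore] -/
def innerFuns (B : BoxQ) : List LinFun := [B.innerFun 0, B.innerFun 1, B.innerFun 2, B.innerFun 3]

/-- In-step condition of element `j` in strict form (`2/3 < arg_{j-1}`), empty for `j = 0`. [folklore] -/
def inFuns (P : PhaseQ) (j : ℕ) : List LinFun := if j = 0 then [] else [(P.node (j - 1)).step.argGeFun (2 / 3)]

/-- Out-step condition of element `j` in strict form (`arg_j < 1/3`), empty for the last element. [folklore] -/
def outFuns (P : PhaseQ) (j : ℕ) : List LinFun := if j + 1 < P.K then [(P.node j).step.argLeFun (1 / 3)] else []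

/-- **The functionals of the cover case of a piece of element `k` with tag `tag`** (`none` if the
tag is not admissible at `k`): core (`0`), junction with the predecessor (`1`), junction with the
successor (`2`), before the tube (`3`: `arg_{k-1} < 1/3`, so the piece carries no point of the tube
box), after the tube (`4`: `arg_k > 2/3`), outside the unit square (`5`–`8`: `z₀ < 0`, `z₀ > 1`,
`z₁ < 0`, `z₁ > 1`; only for the first and the last element, whose stubs cross the gates). [folklore] -/
def caseFuns (P : PhaseQ) (k tag : ℕ) : Option (List LinFun) :=
  if tag = 0 then some (innerFuns (P.node k).box ++ P.inFuns k ++ P.outFuns k)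
  else if tag = 1 then
    (if k = 0 then none else
      some (innerFuns (P.node (k - 1)).box ++ innerFuns (P.node k).box ++ P.inFuns (k - 1) ++ P.outFuns k ++ P.agreeFuns (k - 1)))
  else if tag = 2 then
    (if k + 1 < P.K then
      some (innerFuns (P.node k).box ++ innerFuns (P.node (k + 1)).box ++ P.inFuns k ++ P.outFuns (k + 1) ++ P.agreeFuns k)
    else none)
  else if tag = 3 then
    (if k = 0 then none else some ([(P.node (k - 1)).step.argLeFun (1 / 3)] ++ P.outFuns k))
  else if tag = 4 then
    (if k + 1 < P.K then some ([(P.node k).step.argGeFun (2 / 3)] ++ P.inFuns k) else none)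
  else if tag = 5 then (if k = 0 ∨ P.K ≤ k + 1 then some [⟨1, 0, Aff.const 0⟩] else none)
  else if tag = 6 then (if k = 0 ∨ P.K ≤ k + 1 then some [⟨-1, 0, Aff.const 1⟩] else none)
  else if tag = 7 then (if k = 0 ∨ P.K ≤ k + 1 then some [⟨0, 1, Aff.const 0⟩] else none)
  else if tag = 8 then (if k = 0 ∨ P.K ≤ k + 1 then some [⟨0, -1, Aff.const 1⟩] else none)
  else none

/-- **Inversion of the case functionals**: which list a tag names, with its admissibility. [folklore] -/
theorem caseFuns_cases {k tag : ℕ} {L : List LinFun} (hL : P.caseFuns k tag = some L) :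
    L = innerFuns (P.node k).box ++ P.inFuns k ++ P.outFuns k ∨
    (k ≠ 0 ∧ L = innerFuns (P.node (k - 1)).box ++ innerFuns (P.node k).box ++ P.inFuns (k - 1) ++ P.outFuns k ++ P.agreeFuns (k - 1)) ∨
    (k + 1 < P.K ∧ L = innerFuns (P.node k).box ++ innerFuns (P.node (k + 1)).box ++ P.inFuns k ++ P.outFuns (k + 1) ++ P.agreeFuns k) ∨
    (k ≠ 0 ∧ L = [(P.node (k - 1)).step.argLeFun (1 / 3)] ++ P.outFuns k) ∨
    (k + 1 < P.K ∧ L = [(P.node k).step.argGeFun (2 / 3)] ++ P.inFuns k) ∨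
    ((k = 0 ∨ P.K ≤ k + 1) ∧ (L = [⟨1, 0, Aff.const 0⟩] ∨ L = [⟨-1, 0, Aff.const 1⟩] ∨ L = [⟨0, 1, Aff.const 0⟩] ∨
      L = [⟨0, -1, Aff.const 1⟩])) := by
  unfold caseFuns at hL
  by_cases h0 : tag = 0
  · rw [if_pos h0] at hL; cases hL; exact Or.inl rfl
  rw [if_neg h0] at hL
  by_cases h1 : tag = 1
  · rw [if_pos h1] at hL
    by_cases hk : k = 0
    · rw [if_pos hk] at hL; cases hL
    · rw [if_neg hk] at hL; cases hL; exact Or.inr (Or.inl ⟨hk, rfl⟩)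
  rw [if_neg h1] at hL
  by_cases h2 : tag = 2
  · rw [if_pos h2] at hL
    by_cases hk : k + 1 < P.K
    · rw [if_pos hk] at hL; cases hL; exact Or.inr (Or.inr (Or.inl ⟨hk, rfl⟩))
    · rw [if_neg hk] at hL; cases hL
  rw [if_neg h2] at hL
  by_cases h3 : tag = 3
  · rw [if_pos h3] at hL
    by_cases hk : k = 0
    · rw [if_pos hk] at hL; cases hL
    · rw [if_neg hk] at hL; cases hL; exact Or.inr (Or.inr (Or.inr (Or.inl ⟨hk, rfl⟩)))
  rw [if_neg h3] at hL
  by_cases h4 : tag = 4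
  · rw [if_pos h4] at hL
    by_cases hk : k + 1 < P.K
    · rw [if_pos hk] at hL; cases hL; exact Or.inr (Or.inr (Or.inr (Or.inr (Or.inl ⟨hk, rfl⟩))))
    · rw [if_neg hk] at hL; cases hL
  rw [if_neg h4] at hL
  by_cases h5 : tag = 5
  · rw [if_pos h5] at hL
    by_cases hk : k = 0 ∨ P.K ≤ k + 1
    · rw [if_pos hk] at hL; cases hL; exact Or.inr (Or.inr (Or.inr (Or.inr (Or.inr ⟨hk, Or.inl rfl⟩))))
    · rw [if_neg hk] at hL; cases hL
  rw [if_neg h5] at hL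
  by_cases h6 : tag = 6
  · rw [if_pos h6] at hL
    by_cases hk : k = 0 ∨ P.K ≤ k + 1
    · rw [if_pos hk] at hL; cases hL; exact Or.inr (Or.inr (Or.inr (Or.inr (Or.inr ⟨hk, Or.inr (Or.inl rfl)⟩))))
    · rw [if_neg hk] at hL; cases hL
  rw [if_neg h6] at hL
  by_cases h7 : tag = 7
  · rw [if_pos h7] at hL
    by_cases hk : k = 0 ∨ P.K ≤ k + 1
    · rw [if_pos hk] at hL; cases hL; exact Or.inr (Or.inr (Or.inr (Or.inr (Or.inr ⟨hk, Or.inr (Or.inr (Or.inl rfl))⟩))))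
    · rw [if_neg hk] at hL; cases hL
  rw [if_neg h7] at hL
  by_cases h8 : tag = 8
  · rw [if_pos h8] at hL
    by_cases hk : k = 0 ∨ P.K ≤ k + 1
    · rw [if_pos hk] at hL; cases hL; exact Or.inr (Or.inr (Or.inr (Or.inr (Or.inr ⟨hk, Or.inr (Or.inr (Or.inr rfl))⟩))))
    · rw [if_neg hk] at hL; cases hL
  rw [if_neg h8] at hL
  cases hL

/-- **Piece test of element `k`**: the clips and coverage of its pieces, and for every piece the
strict corner test of every functional of its cover case. [folklore] -/
def piecesB (P : PhaseQ) (k : ℕ) : Bool :=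
  (P.node k).e.piecesOKB (P.node k).ann (P.node k).box P.r₀ &&
    (P.node k).ann.pieces.all fun π =>
      match P.caseFuns k π.tag with
      | none => false
      | some L => L.all fun φ => (P.node k).e.pieceFunLtB φ π P.r₀

/-- **All geometric checks of a phase.** [folklore] -/
def geomB : Bool :=
  P.elemsValidB && P.allPosB && (List.range P.K).all fun k => P.fwdB k && P.bwdB k && P.piecesB k

variable {P}

/-! ### Consequences -/

/-- The out-step of the fully frozen chain in terms of the rational step. [folklore] -/
theorem frozenAt_sigmaOut_eq (s t : ℝ) (k : ℕ) (z : E²) :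
    (P.chain.frozenAt s).sigmaOut k t z = if k + 1 < P.K then ((P.node k).step.toJ P.T0 P.Tau).val s z else 0 := by
  rw [MovingChain.frozenAt_sigmaOut]; rfl

/-- **Forward order from the test.** [folklore] -/
theorem order_fwd_of_fwdB (hpos : P.allPosB = true) {k : ℕ} (hk : k + 1 < P.K) (h : P.fwdB k = true) (s t : ℝ) (z : E²)
    (hz : z ∈ ((P.chain.frozenAt s).B (k + 1)).supp) (hz' : z ∈ ((P.chain.frozenAt s).B k).inner)
    (h0 : (P.chain.frozenAt s).sigmaOut k t z = 0) : (P.chain.frozenAt s).sigmaOut (k + 1) t z = 0 := by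
  rw [frozenAt_sigmaOut_eq]
  split_ifs with hk2
  · rw [frozenAt_sigmaOut_eq, if_pos hk] at h0
    rw [frozenAt_B] at hz hz'
    simp only [fwdB, Bool.or_eq_true, decide_eq_true_eq] at h
    rcases h with (hK | hsup) | hinf
    · omega
    · refine JStep.val_eq_zero _ ?_
      have := (P.node (k + 1)).step.arg_le_of_supLeB (step_len_pos hpos (by omega)) hsup (t₀ := P.T0) (τ := P.Tau) (t := s)
        (hisOf_bound hz hz') (losOf_bound hz hz')
      push_cast at this; exact this
    · exfalso
      have hgt := (P.node k).step.lt_arg_of_infGtB (step_len_pos hpos (by omega)) hinf (t₀ := P.T0) (τ := P.Tau) (t := s)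
        (hisOf_bound hz hz') (losOf_bound hz hz')
      have hle := JStep.arg_le_of_val_eq_zero _ h0
      push_cast at hgt; linarith
  · rfl

/-- **Backward order from the test.** [folklore] -/
theorem order_bwd_of_bwdB (hpos : P.allPosB = true) {k : ℕ} (hk : k + 1 < P.K) (h : P.bwdB k = true) (s t : ℝ) (z : E²)
    (hz : z ∈ ((P.chain.frozenAt s).B k).supp) (hz' : z ∈ ((P.chain.frozenAt s).B (k + 1)).inner)
    (h1 : (P.chain.frozenAt s).sigmaOut k t z = 1) : (P.chain.frozenAt s).sigmaIn k t z = 1 := by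
  rw [MovingChain.frozenAt_sigmaIn]
  unfold ChainData.sigmaIn
  split_ifs with hk0
  · rfl
  · rw [frozenAt_sigmaOut_eq, if_pos hk] at h1
    rw [frozenAt_B] at hz hz'
    simp only [bwdB, Bool.or_eq_true, decide_eq_true_eq] at h
    rcases h with (hK | hinf) | hsup
    · exact absurd hK hk0
    · show (P.chain.frozen s).sigmaOut (k - 1) s z = 1
      unfold ChainData.sigmaOut
      rw [if_pos (by simp; omega)]
      exact JStep.val_eq_one _ (by
        have := (P.node (k - 1)).step.le_arg_of_infGeB (step_len_pos hpos (by omega)) hinf (t₀ := P.T0) (τ := P.Tau) (t := s)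
          (hisOf_bound hz hz') (losOf_bound hz hz')
        push_cast at this; exact this)
    · exfalso
      have hlt := (P.node k).step.arg_lt_of_supLtB (step_len_pos hpos (by omega)) hsup (t₀ := P.T0) (τ := P.Tau) (t := s)
        (hisOf_bound hz hz') (losOf_bound hz hz')
      have hge := JStep.arg_ge_of_val_eq_one _ h1
      push_cast at hlt; linarith

/-! ### Reading the case functionals -/

/-- Inner functionals give membership in the inner box. [folklore] -/
theorem mem_inner_of_innerFuns {B : BoxQ} {α : ℝ} {z : E²} (h : ∀ φ ∈ innerFuns B, φ.eval α z < 0) :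
    z ∈ (B.frzAt α).inner :=
  B.mem_inner_of_innerFun_neg fun q => by
    fin_cases q
    · exact h _ (by simp [innerFuns])
    · exact h _ (by simp [innerFuns])
    · exact h _ (by simp [innerFuns])
    · exact h _ (by simp [innerFuns])

/-- In-step functionals give the in-step condition. [folklore] -/
theorem inOne_of_inFuns (hpos : P.allPosB = true) {j : ℕ} (hj : j < P.K) {t : ℝ} {z : E²}
    (h : ∀ φ ∈ P.inFuns j, φ.eval (clock P.T0 P.Tau t) z < 0) :
    j = 0 ∨ (2 / 3 : ℝ) < ((P.node (j - 1)).step.toJ P.T0 P.Tau).arg t z := by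
  by_cases h0 : j = 0
  · exact Or.inl h0
  · right
    have hφ := h ((P.node (j - 1)).step.argGeFun (2 / 3)) (by simp [inFuns, h0])
    have := (P.node (j - 1)).step.lt_arg_of_eval_neg (step_len_pos hpos (by omega)) hφ
    push_cast at this; exact this

/-- Out-step functionals give the out-step condition. [folklore] -/
theorem outZero_of_outFuns (hpos : P.allPosB = true) {j : ℕ} {t : ℝ} {z : E²}
    (h : ∀ φ ∈ P.outFuns j, φ.eval (clock P.T0 P.Tau t) z < 0) :
    j + 1 < P.K → ((P.node j).step.toJ P.T0 P.Tau).arg t z < 1 / 3 := by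
  intro hj
  have hφ := h ((P.node j).step.argLeFun (1 / 3)) (by simp [outFuns, hj])
  have := (P.node j).step.arg_lt_of_eval_neg (step_len_pos hpos (by omega)) hφ
  push_cast at this
  linarith

/-- Agreement functionals give membership in the agreement region. [folklore] -/
theorem mem_Agree_of_agreeFuns {j : ℕ} {t : ℝ} {z : E²} (h : ∀ φ ∈ P.agreeFuns j, φ.eval (clock P.T0 P.Tau t) z < 0) :
    (t, z) ∈ P.Agree j := h

/-- **The case functionals of the piece containing a band point are strictly negative there.** [folklore] -/
theorem caseFuns_neg {k : ℕ} (hv : (P.node k).e.validB = true) (hpc : P.piecesB k = true) {p : ℝ × E²} (hp : p ∈ P.Band k)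
    (hz : p.2 ∈ ((P.node k).box.frzAt (clock P.T0 P.Tau p.1)).supp) :
    ∃ tag L, P.caseFuns k tag = some L ∧ ∀ φ ∈ L, φ.eval (clock P.T0 P.Tau p.1) p.2 < 0 := by
  simp only [piecesB, Bool.and_eq_true, List.all_eq_true] at hpc
  obtain ⟨hok, hall⟩ := hpc
  obtain ⟨π, hmem, hu, hreg⟩ := (P.node k).e.exists_piece hv hok hp hz
  have hr := (P.node k).e.r0_nonneg_of_piecesOKB hok
  have hπ := hall π hmem
  cases hL : P.caseFuns k π.tag with
  | none => rw [hL] at hπ; exact absurd hπ (by simp)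
  | some L =>
    rw [hL] at hπ
    simp only [List.all_eq_true] at hπ
    exact ⟨π.tag, L, hL, fun φ hφ => (P.node k).e.lt_of_pieceFunLtB hv hr (hπ φ hφ) hreg hp hu⟩

/-- Membership in the core of the moving chain, unfolded. [folklore] -/
theorem mem_core_iff (k : ℕ) (p : ℝ × E²) : p ∈ P.chain.core k ↔
    p.2 ∈ ((P.node k).box.frzAt (clock P.T0 P.Tau p.1)).inner ∧
      (k = 0 ∨ (2 / 3 : ℝ) < ((P.node (k - 1)).step.toJ P.T0 P.Tau).arg p.1 p.2) ∧
      (k + 1 < P.K → ((P.node k).step.toJ P.T0 P.Tau).arg p.1 p.2 < 1 / 3) := by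
  simp only [MovingChain.core, ChainData.core, ChainData.inOne, ChainData.outZero, mem_setOf_eq, mem_inter_iff,
    MovingChain.frozen_B, chain_box, BoxQ.moving_frz, MovingChain.frozen_J, chain_J, MovingChain.frozen_K, chain_K, and_assoc]

/-- Membership in a junction region of the moving chain, unfolded. [folklore] -/
theorem mem_juncCut_iff (k : ℕ) (p : ℝ × E²) : p ∈ P.chain.juncCut k ↔
    (p.2 ∈ ((P.node k).box.frzAt (clock P.T0 P.Tau p.1)).inner ∧ p.2 ∈ ((P.node (k + 1)).box.frzAt (clock P.T0 P.Tau p.1)).inner) ∧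
      (k = 0 ∨ (2 / 3 : ℝ) < ((P.node (k - 1)).step.toJ P.T0 P.Tau).arg p.1 p.2) ∧
      (k + 1 + 1 < P.K → ((P.node (k + 1)).step.toJ P.T0 P.Tau).arg p.1 p.2 < 1 / 3) := by
  simp only [MovingChain.juncCut, ChainData.juncCut, ChainData.inOne, ChainData.outZero, mem_setOf_eq, mem_inter_iff,
    MovingChain.frozen_B, chain_box, BoxQ.moving_frz, MovingChain.frozen_J, chain_J, MovingChain.frozen_K, chain_K, and_assoc]

/-- **The cover case of a band point from its case functionals**, given the two step conditions
of the tube box (`1/3 ≤ arg_{k-1}` unless `k = 0`, `arg_k ≤ 2/3` unless `k` is last). [folklore] -/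
theorem cover_of_caseFuns (hpos : P.allPosB = true) {k : ℕ} (hk : k < P.K) {tag : ℕ} {L : List LinFun}
    (hL : P.caseFuns k tag = some L) {t : ℝ} {z : E²} (h : ∀ φ ∈ L, φ.eval (clock P.T0 P.Tau t) z < 0)
    (htin : k = 0 ∨ (1 / 3 : ℝ) ≤ ((P.node (k - 1)).step.toJ P.T0 P.Tau).arg t z)
    (htout : k + 1 < P.K → ((P.node k).step.toJ P.T0 P.Tau).arg t z ≤ 2 / 3) (hQ : ∀ j, 0 ≤ z j ∧ z j ≤ 1) :
    (t, z) ∈ P.chain.core k ∨ (0 < k ∧ (t, z) ∈ P.chain.juncCut (k - 1) ∩ P.Agree (k - 1)) ∨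
      (k + 1 < P.K ∧ (t, z) ∈ P.chain.juncCut k ∩ P.Agree k) := by
  rcases P.caseFuns_cases hL with rfl | ⟨hk0, rfl⟩ | ⟨hk1, rfl⟩ | ⟨hk3, rfl⟩ | ⟨hk4, rfl⟩ | ⟨_, hout⟩
  · -- core
    left
    rw [mem_core_iff]
    refine ⟨mem_inner_of_innerFuns fun φ hφ => h φ (by simp [hφ]), inOne_of_inFuns hpos hk fun φ hφ => h φ (by simp [hφ]),
      outZero_of_outFuns hpos fun φ hφ => h φ (by simp [hφ])⟩
  · -- junction with the predecessor
    right; left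
    refine ⟨Nat.pos_of_ne_zero hk0, ?_, mem_Agree_of_agreeFuns fun φ hφ => h φ (by simp [hφ])⟩
    rw [mem_juncCut_iff]
    have e : k - 1 + 1 = k := by omega
    refine ⟨⟨mem_inner_of_innerFuns fun φ hφ => h φ (by simp [hφ]), ?_⟩, ?_, ?_⟩
    · rw [e]; exact mem_inner_of_innerFuns fun φ hφ => h φ (by simp [hφ])
    · exact inOne_of_inFuns hpos (by omega) fun φ hφ => h φ (by simp [hφ])
    · rw [e]; exact outZero_of_outFuns hpos fun φ hφ => h φ (by simp [hφ])
  · -- junction with the successor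
    right; right
    refine ⟨hk1, ?_, mem_Agree_of_agreeFuns fun φ hφ => h φ (by simp [hφ])⟩
    rw [mem_juncCut_iff]
    exact ⟨⟨mem_inner_of_innerFuns fun φ hφ => h φ (by simp [hφ]), mem_inner_of_innerFuns fun φ hφ => h φ (by simp [hφ])⟩,
      inOne_of_inFuns hpos hk fun φ hφ => h φ (by simp [hφ]), outZero_of_outFuns hpos fun φ hφ => h φ (by simp [hφ])⟩
  · -- before the tube: contradicts the in-step condition of the tube box
    exfalso
    rcases htin with h00 | hge
    · exact hk3 h00
    · have hφ := h ((P.node (k - 1)).step.argLeFun (1 / 3)) (by simp)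
      have hlt := (P.node (k - 1)).step.arg_lt_of_eval_neg (step_len_pos hpos (by omega)) hφ
      push_cast at hlt; linarith
  · -- after the tube: contradicts the out-step condition of the tube box
    exfalso
    have hφ := h ((P.node k).step.argGeFun (2 / 3)) (by simp)
    have hgt := (P.node k).step.lt_arg_of_eval_neg (step_len_pos hpos hk) hφ
    have hle := htout hk4
    push_cast at hgt; linarith
  · -- outside the square: contradicts `z ∈ [0,1]²`
    exfalso
    rcases hout with rfl | rfl | rfl | rfl <;>
    · have hφ := h _ (List.mem_singleton_self _)
      simp only [LinFun.eval, Aff.eval_const] at hφ; push_cast at hφ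
      linarith [(hQ 0).1, (hQ 0).2, (hQ 1).1, (hQ 1).2]

/-- **Order on the band from the piece test.** [folklore] -/
theorem order_band_of_piecesB (hpos : P.allPosB = true) {k : ℕ} (hk : k < P.K) (hv : (P.node k).e.validB = true)
    (hpc : P.piecesB k = true) (s t : ℝ) (z : E²) (hz : z ∈ ((P.chain.frozenAt s).B k).supp)
    (hband : (t, z) ∈ MovingChain.bandSlice P.Band s k) (hσ : 0 < (P.chain.frozenAt s).sigmaOut k t z) :
    (P.chain.frozenAt s).sigmaIn k t z = 1 := by
  rw [frozenAt_sigmaOut_eq] at hσ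
  split_ifs at hσ with hk1
  swap; · exact absurd hσ (lt_irrefl 0)
  have harg : (1 / 3 : ℝ) < ((P.node k).step.toJ P.T0 P.Tau).arg s z := JStep.arg_gt_of_val_pos _ hσ
  rw [frozenAt_B] at hz
  rw [MovingChain.mem_bandSlice] at hband
  obtain ⟨tag, L, hL, hneg⟩ := P.caseFuns_neg hv hpc (p := (s, z)) hband hz
  -- conclude from `k = 0 ∨ 2/3 < arg_{k-1}`
  have finish : (k = 0 ∨ (2 / 3 : ℝ) < ((P.node (k - 1)).step.toJ P.T0 P.Tau).arg s z) →
      (P.chain.frozenAt s).sigmaIn k t z = 1 := by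
    intro hin
    rw [MovingChain.frozenAt_sigmaIn]
    unfold ChainData.sigmaIn
    split_ifs with hk0
    · rfl
    · rcases hin with h0 | hgt
      · exact absurd h0 hk0
      · show (P.chain.frozen s).sigmaOut (k - 1) s z = 1
        unfold ChainData.sigmaOut
        rw [if_pos (by simp; omega)]
        exact JStep.val_eq_one _ hgt.le
  -- the out-step condition `arg_k < 1/3` is impossible here
  have noOut : ¬ (∀ φ ∈ P.outFuns k, φ.eval (clock P.T0 P.Tau s) z < 0) := fun hout => by
    have := outZero_of_outFuns hpos hout hk1
    linarith
  rcases P.caseFuns_cases hL with rfl | ⟨_, rfl⟩ | ⟨_, rfl⟩ | ⟨_, rfl⟩ | ⟨_, rfl⟩ | ⟨hend, _⟩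
  · exact absurd (fun φ hφ => hneg φ (by simp [hφ])) noOut
  · exact absurd (fun φ hφ => hneg φ (by simp [hφ])) noOut
  · exact finish (inOne_of_inFuns hpos hk fun φ hφ => hneg φ (by simp [hφ]))
  · exact absurd (fun φ hφ => hneg φ (by simp [hφ])) noOut
  · exact finish (inOne_of_inFuns hpos hk fun φ hφ => hneg φ (by simp [hφ]))
  · rcases hend with h0 | hK
    · exact finish (Or.inl h0)
    · omega

/-! ### The assembled consequences of the geometric checks -/

/-- Unpacking the geometric checks at an index. [folklore] -/
theorem geomB_at (h : P.geomB = true) {k : ℕ} (hk : k < P.K) :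
    P.elemsValidB = true ∧ P.allPosB = true ∧ P.fwdB k = true ∧ P.bwdB k = true ∧ P.piecesB k = true := by
  simp only [geomB, Bool.and_eq_true, List.all_eq_true, List.mem_range] at h
  obtain ⟨⟨hv, hpos⟩, hall⟩ := h
  obtain ⟨⟨h1, h2⟩, h3⟩ := hall k hk
  exact ⟨hv, hpos, h1, h2, h3⟩

/-- **The order conditions of a phase from its geometric checks.** [folklore] -/
theorem orders_of_geomB (h : P.geomB = true) : P.Orders where
  fwd s k hk t z hz hz' h0 := by
    obtain ⟨_, hpos, hf, _, _⟩ := geomB_at h (k := k) (by omega)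
    exact order_fwd_of_fwdB hpos hk hf s t z hz hz' h0
  bwd s k hk t z hz hz' h1 := by
    obtain ⟨_, hpos, _, hb, _⟩ := geomB_at h (k := k) (by omega)
    exact order_bwd_of_bwdB hpos hk hb s t z hz hz' h1
  band s k hk t z hz hband hσ := by
    obtain ⟨hv, hpos, _, _, hpc⟩ := geomB_at h hk
    exact order_band_of_piecesB hpos hk (validB_node hv hk) hpc s t z hz hband hσ

/-- **Diagonal well-formedness of a phase from its checks.** [folklore] -/
theorem wfbd_of_geomB (h : P.geomB = true) (hsep : P.boxSepB = true) : P.chain.WFBd P.Band := by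
  have hK : P.elemsValidB = true ∧ P.allPosB = true := by
    simp only [geomB, Bool.and_eq_true] at h; exact ⟨h.1.1, h.1.2⟩
  exact wfbd hK.2 hsep (orders_of_geomB h)

/-- **The cover of a phase from its geometric checks** (all times, all points of the unit square). [folklore] -/
theorem cover_of_geomB (h : P.geomB = true) (t : ℝ) {z : E²} (hQ : ∀ j, 0 ≤ z j ∧ z j ≤ 1) {k : ℕ} (hk : k < P.K)
    (hp : (t, z) ∈ P.chain.tubeBox k ∩ P.Band k) :
    (t, z) ∈ P.chain.core k ∨ (0 < k ∧ (t, z) ∈ P.chain.juncCut (k - 1) ∩ P.Agree (k - 1)) ∨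
      (k + 1 < P.K ∧ (t, z) ∈ P.chain.juncCut k ∩ P.Agree k) := by
  obtain ⟨hv, hpos, _, _, hpc⟩ := geomB_at h hk
  have hz : z ∈ ((P.node k).box.frzAt (clock P.T0 P.Tau t)).supp := hp.1.1.1
  obtain ⟨tag, L, hL, hneg⟩ := P.caseFuns_neg (validB_node hv hk) hpc hp.2 hz
  have htin : k = 0 ∨ (1 / 3 : ℝ) ≤ ((P.node (k - 1)).step.toJ P.T0 P.Tau).arg t z := hp.1.1.2
  have htout : k + 1 < P.K → ((P.node k).step.toJ P.T0 P.Tau).arg t z ≤ 2 / 3 := hp.1.2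
  exact P.cover_of_caseFuns hpos hk hL hneg htin htout hQ

end PhaseQ

end PlanarKinematics

end Literature.Analysis.FluidPDE
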